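import Summits.Ventures.QEC.CircuitDistance.PortK2DataBB144Z
import Summits.Ventures.QEC.CircuitDistance.K2Chunks
import HarnessLib

/-!
# K2(`[[144,12,12]]`) chunk module — COMPUTATIONAL (native_decide; `Lean.ofReduceBool`)

Cell `qec`, CDX, R146/R152 STEP 1 («computational» header; `ofReduceBool` confined to these chunk modules). Checker of record
`K2.K2Data` (qec-cdx-type-1, PortK2Check); data module of record `PortK2DataBB144X/Z` (p669158/9, crit-1 data audit PASS
2026-08-28T21:20Z); chunk glue `K2Chunks` (idea-1 g2). Cube 0, child 15: leaf group 3 of 5.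
Leaf theorems: the K2 DFS accepts below one descendant state of pivot cube 0 (sector Z); sizes are exact DFS visit counts
(eng-1 g2 `k2count.c`), capped so that the gate's native-axiom audit re-verifies every leaf in place. Assemblies re-derive the
child lists in the kernel (`decide`) and end in the literal cube fact `d144Z.cube (Ts144Z.getD 0 []) (0) (lives144Z.getD 0 0) = true`
(the `hcubes` hypothesis of `K2Inst.k2_complete`). Emitted by qec-cdx-eng-1 g2 (`gen2.py`, idea-1's `gen_k2chunks_from_lean.py` lineage).
-/

namespace Summit.Ventures.QEC.CircuitDistance.K2

set_option maxRecDepth 100000 in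
set_option maxHeartbeats 0 in
set_option exponentiation.threshold 1024 in
/-- K2(144) chunk fact `cube144Z0_ch15_8` (398166 DFS visits; see the module docstring). -/
theorem cube144Z0_ch15_8 : app5 (d144Z.dfs (Ts144Z.getD 0 []) 6) (299777605597433697344, 1896, 1809251394333065553493296664144774757501790201659591136577053064618563338241, 3, 2348542582773833227889480596789335189854296659006109231563334517418884263811682112638754528775968940240142300) = true := by native_decide

set_option maxRecDepth 100000 in
set_option maxHeartbeats 0 in
set_option exponentiation.threshold 1024 in
/-- K2(144) chunk fact `cube144Z0_ch15_9` (336192 DFS visits; see the module docstring). -/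
theorem cube144Z0_ch15_9 : app5 (d144Z.dfs (Ts144Z.getD 0 []) 6) (2361201255834492896512, 488, 1809251394333065553493308613382161574964049434986783424907021771523034710017, 3, 2348542582773833227889480596789335189854296659006109231551361896005869507105757526489142738278947540848082908) = true := by native_decide

set_option maxRecDepth 100000 in
set_option maxHeartbeats 0 in
set_option exponentiation.threshold 1024 in
/-- K2(144) chunk fact `cube144Z0_ch15_10` (489009 DFS visits; see the module docstring). -/
theorem cube144Z0_ch15_10 : app5 (d144Z.dfs (Ts144Z.getD 0 []) 6) (18014398713973760, 2536, 1809251394333065553494062888531181504636522683914208967708334119684734451713, 3, 2348542582773833227889480596789335189854296659006109230785114125572925077926584012913988146469577979756281820) = true := by native_decide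

set_option maxRecDepth 100000 in
set_option maxHeartbeats 0 in
set_option exponentiation.threshold 1024 in
/-- K2(144) chunk fact `cube144Z0_ch15_11` (345275 DFS visits; see the module docstring). -/
theorem cube144Z0_ch15_11 : app5 (d144Z.dfs (Ts144Z.getD 0 []) 6) (149900096982727263232, 1888, 1809251395175563886841754134344092781676706968951794576320917640158130470913, 3, 2348542582773833227889480596789335189854295816507775882327620542228703608563125461753224942076687945268461532) = true := by native_decide

set_option maxRecDepth 100000 in
set_option maxHeartbeats 0 in
set_option exponentiation.threshold 1024 in
/-- K2(144) chunk fact `cube144Z0_ch15_12` (334082 DFS visits; see the module docstring). -/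
theorem cube144Z0_ch15_12 : app5 (d144Z.dfs (Ts144Z.getD 0 []) 6) (2361237847581446374912, 1416, 1809251407813038887068616538094256103717158847219206024386810990675447775233, 3, 2348542582773833227889480596789335189854282336534442307007723208721160098747788643181013671790447393463336924) = true := by native_decide
end Summit.Ventures.QEC.CircuitDistance.K2
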